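import Mathlib.RingTheory.Jacobson.Ideal
import Mathlib.RingTheory.Ideal.Quotient.Operations
import HarnessLib

/-!
# Skinner–Urban 2014, Lemma 3.1.7: identifying an ideal with a principal ideal modulo an ideal in
# the Jacobson radical (the algebra behind Thms. 3.6.5–3.6.6)

C. Skinner, E. Urban, *The Iwasawa main conjectures for `GL₂`*, Invent. Math. 195 (2014), 1–277
(bib key `SkinnerUrban2014`; held author version `paper:doi-10-1007-s00222-013-0448-1`, whose
three-level numbering and pages are used in every `[cite:]` of the tree for this source).

**Lemma 3.1.7, as printed** (§3.1.6–3.1.7, p. 20, ll. 20–30 of the held text): "Let `A` be a ring,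
`𝔞 ⊂ A` a proper ideal contained in the Jacobson radical of `A`, and assume that `A/𝔞` is a
domain. Let `L ∈ A` be such that its reduction `L̄` modulo `𝔞` is non-zero. Let `I ⊆ (L)` be an
ideal and let `Ī` its image in `A/𝔞`. If `L̄ ∈ Ī`, then `I = (L)`." Printed proof: "We need to
show that `L ∈ I`. … there exists `α ∈ I` such that `ᾱ = L̄`. On the other hand, since `I ⊆ (L)`,
there exists `β ∈ A` such that `α = βL`. Therefore `L̄ = β̄ L̄`, and hence `β̄ = 1` since `A/𝔞` is
a domain and `L̄` is non-zero. As `𝔞` is contained in the radical of `A`, it then follows that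
`β` is a unit in `A`, so `L = β⁻¹ α ∈ I`."

This is the lemma by which Skinner–Urban pass from ONE divisibility plus an equality after
specialisation to an equality of ideals: proof of Thm. 3.6.5 (p. 44: "`J ⊆ I ⊆ (L)` … `J mod 𝔞 =
… = (L) mod 𝔞` by Theorem 3.6.4. The equalities `J = I = (L)` then follows from Lemma 3.1.7",
`𝔞 = ker (𝒪_L⟦Γ_K⟧ → 𝒪_L⟦Γ_ℚ⟧)`) and of Thm. 3.6.6 (p. 45, the three-variable main conjecture,
`𝔞 = ker (𝕀⟦Γ_K⟧ → 𝒪_L⟦Γ_K⟧)` induced by an arithmetic point `φ`). It is PROVED here as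
printed (pure commutative algebra; Mathlib's `Ideal.jacobson ⊥` is the Jacobson radical of `A`,
`Ideal.mem_jacobson_bot : x ∈ Jac(A) ↔ ∀ y, IsUnit (x y + 1)`), together with the two-ideal form
actually invoked on pp. 44–45 (`J ⊆ I ⊆ (L)`, `L̄ ∈ J̄` ⟹ `J = I = (L)`). The hypothesis "`𝔞`
proper" is implied by "`A/𝔞` is a domain" (a domain is nontrivial) and is not repeated.

Theorems only (no `def`, no named fact; D-0014/D-0026). Namespace
`Literature.NumberTheory.EllipticCurves.SkinnerUrban2014` (the paper's algebraic lemmas are grouped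
there, cf. `PAdicBSDSkinnerUrbanSkeletonProofs`: `span_eq_of_mem_of_mul_le`, p. 43).

## References

* C. Skinner, E. Urban, Invent. Math. 195 (2014), §3.1.6–3.1.7 (pp. 19–20), proofs of
  Thm. 3.6.5 (p. 44) and Thm. 3.6.6 (pp. 44–45). [SkinnerUrban2014]
-/

namespace Literature.NumberTheory.EllipticCurves.SkinnerUrban2014

variable {A : Type*} [CommRing A]

/-- **Skinner–Urban 2014, Lemma 3.1.7.** Let `𝔞` be an ideal of the commutative ring `A`
contained in the Jacobson radical of `A` with `A/𝔞` a domain, `L ∈ A` with `L̄ ≠ 0` in `A/𝔞`,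
and `I ⊆ (L)` an ideal whose image `Ī ⊆ A/𝔞` contains `L̄`. Then `I = (L)`. (Printed proof:
`α ∈ I` with `ᾱ = L̄`, `α = βL`, `β̄ = 1` by cancellation in the domain `A/𝔞`, so `β ∈ 1 + 𝔞` is a
unit and `L = β⁻¹α ∈ I`.) [cite: SkinnerUrban2014, Lemma 3.1.7 (p. 20)] -/
theorem eq_span_singleton_of_le_of_mem_map {𝔞 : Ideal A}
    (h𝔞 : 𝔞 ≤ (⊥ : Ideal A).jacobson) [IsDomain (A ⧸ 𝔞)] {L : A}
    (hL : Ideal.Quotient.mk 𝔞 L ≠ 0) {I : Ideal A} (hI : I ≤ Ideal.span {L})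
    (hLI : Ideal.Quotient.mk 𝔞 L ∈ I.map (Ideal.Quotient.mk 𝔞)) : I = Ideal.span {L} := by
  refine le_antisymm hI ((Ideal.span_singleton_le_iff_mem _).2 ?_)
  -- `α ∈ I` with `ᾱ = L̄`
  obtain ⟨α, hαI, hα⟩ :=
    (Ideal.mem_map_iff_of_surjective _ Ideal.Quotient.mk_surjective).1 hLI
  -- `α = β L` since `I ⊆ (L)`
  obtain ⟨β, rfl⟩ := Ideal.mem_span_singleton'.1 (hI hαI)
  -- `β̄ = 1` (cancel `L̄ ≠ 0` in the domain `A/𝔞`)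
  have hβ : Ideal.Quotient.mk 𝔞 β = 1 := by
    have h0 : (Ideal.Quotient.mk 𝔞 β - 1) * Ideal.Quotient.mk 𝔞 L = 0 := by
      rw [sub_mul, one_mul, ← map_mul, hα, sub_self]
    exact sub_eq_zero.1 ((mul_eq_zero.1 h0).resolve_right hL)
  -- `β - 1 ∈ 𝔞 ⊆ Jac(A)`, so `β` is a unit
  have hβ1 : β - 1 ∈ 𝔞 := by
    rw [← Ideal.Quotient.eq, hβ, map_one]
  have hu : IsUnit β := by
    simpa using Ideal.mem_jacobson_bot.1 (h𝔞 hβ1) 1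
  obtain ⟨u, rfl⟩ := hu
  -- `L = u⁻¹ (u L) ∈ I`
  have hL' : ((u⁻¹ : Aˣ) : A) * ((u : A) * L) = L := by
    rw [← mul_assoc, Units.inv_mul, one_mul]
  rw [← hL']
  exact I.mul_mem_left _ hαI

/-- **The form used in the proofs of Thms. 3.6.5 and 3.6.6** (pp. 44–45): if `J ⊆ I ⊆ (L)` with
`L̄ ≠ 0` in the domain `A/𝔞`, `𝔞 ⊆ Jac(A)`, and `L̄ ∈ J̄` ("`J mod 𝔞 = (L) mod 𝔞`"), then
`J = (L)` and `I = (L)` ("The equalities `J = I = (L)` then follows from Lemma 3.1.7").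
[cite: SkinnerUrban2014, Lemma 3.1.7 (p. 20) and proof of Thm. 3.6.5 (p. 44)] -/
theorem eq_span_singleton_of_le_of_le_of_mem_map {𝔞 : Ideal A}
    (h𝔞 : 𝔞 ≤ (⊥ : Ideal A).jacobson) [IsDomain (A ⧸ 𝔞)] {L : A}
    (hL : Ideal.Quotient.mk 𝔞 L ≠ 0) {J I : Ideal A} (hJI : J ≤ I) (hI : I ≤ Ideal.span {L})
    (hLJ : Ideal.Quotient.mk 𝔞 L ∈ J.map (Ideal.Quotient.mk 𝔞)) :
    J = Ideal.span {L} ∧ I = Ideal.span {L} := by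
  have hJ : J = Ideal.span {L} := eq_span_singleton_of_le_of_mem_map h𝔞 hL (hJI.trans hI) hLJ
  exact ⟨hJ, le_antisymm hI (hJ ▸ hJI)⟩

/-- The hypothesis "`L̄ ∈ Ī`" of Lemma 3.1.7 in the form "`(L̄) ⊆ Ī`", i.e. `(L) mod 𝔞 ⊆ I mod 𝔞`
(the images of ideals in `A/𝔞` are `Ideal.map (Ideal.Quotient.mk 𝔞)`): equivalent phrasing,
recorded for callers that compare the two reduced ideals. [cite: SkinnerUrban2014, Lemma 3.1.7 (p. 20)] -/
theorem mk_mem_map_iff_map_span_le {𝔞 : Ideal A} {L : A} {I : Ideal A} :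
    Ideal.Quotient.mk 𝔞 L ∈ I.map (Ideal.Quotient.mk 𝔞) ↔
      (Ideal.span {L}).map (Ideal.Quotient.mk 𝔞) ≤ I.map (Ideal.Quotient.mk 𝔞) := by
  rw [Ideal.map_span, Set.image_singleton, Ideal.span_singleton_le_iff_mem]

/-- **Lemma 3.1.7 with equal reductions**: if `I ⊆ (L)`, `L̄ ≠ 0` in the domain `A/𝔞`,
`𝔞 ⊆ Jac(A)` and `I mod 𝔞 = (L) mod 𝔞`, then `I = (L)`. [cite: SkinnerUrban2014, Lemma 3.1.7 (p. 20)] -/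
theorem eq_span_singleton_of_le_of_map_eq {𝔞 : Ideal A}
    (h𝔞 : 𝔞 ≤ (⊥ : Ideal A).jacobson) [IsDomain (A ⧸ 𝔞)] {L : A}
    (hL : Ideal.Quotient.mk 𝔞 L ≠ 0) {I : Ideal A} (hI : I ≤ Ideal.span {L})
    (hmap : I.map (Ideal.Quotient.mk 𝔞) = (Ideal.span {L}).map (Ideal.Quotient.mk 𝔞)) :
    I = Ideal.span {L} :=
  eq_span_singleton_of_le_of_mem_map h𝔞 hL hI (mk_mem_map_iff_map_span_le.2 hmap.ge)

end Literature.NumberTheory.EllipticCurves.SkinnerUrban2014
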